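import Mathlib
import Literature.Combinatorics.Kakeya.KakeyaMultiplicityBound
import Literature.AlgebraicGeometry.Resolution.HasseSchmidtDerivatives
import HarnessLib

/-!
# Kakeya sets in `𝔽_qⁿ` have at least `(q/2)ⁿ` points: the method of multiplicities with Hasse
# derivatives (Dvir–Kopparty–Saraf–Sudan, Theorems 1.1 and 3.2, Lemma 2.7)

Topic `Literature/Combinatorics/Kakeya`.  Everything in this file is PROVED (no named fact, no
`sorry`).  Third file of the finite-field Kakeya lower bounds of this directory, after
`FiniteFieldKakeya.lean` (Dvir 2009: `|K| ≥ C(q + n − 1, n) ≥ qⁿ/n!`) and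
`KakeyaMultiplicityBound.lean` (Saraf–Sudan 2008: `|K| ≥ qⁿ/C(2n − 1, n) ≥ (q/4)ⁿ`): the
"extended method of multiplicities", which propagates high-multiplicity vanishing through Hasse
derivatives and closes with a multiplicity-enhanced Schwartz–Zippel lemma, giving `|K| ≥ qⁿ/2ⁿ`
— within a factor `2 + o(1)` of the constructions of `SmallKakeyaSets.lean`.

Z. Dvir, S. Kopparty, S. Saraf, M. Sudan, *Extensions to the method of multiplicities, with
applications to Kakeya sets and mergers*, SIAM J. Comput. **42** (2013), no. 6, 2305–2328
(doi:10.1137/100783704; conference version FOCS 2009; arXiv:0901.2529), verbatim from the printed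
text:

> (p. 2307) **Theorem 1.1.** If `K` is a Kakeya set in `𝔽_qⁿ`, then `|K| ≥ (1/2ⁿ) qⁿ`.
>
> (§2.1, p. 2310) **Definition 2.1** ((Hasse) derivative). For `P(X) ∈ 𝔽[X]` and nonnegative
> vector `i`, the `i`th (Hasse) derivative of `P`, denoted `P^{(i)}(X)`, is the coefficient of `Zⁱ`
> in the polynomial `P̃(X, Z) = P(X + Z) ∈ 𝔽[X, Z]`. Thus, `P(X + Z) = ∑ᵢ P^{(i)}(X) Zⁱ`. (2.1)
> **Definition 2.2** (multiplicity). For `P(X) ∈ 𝔽[X]` and `a ∈ 𝔽ⁿ`, the multiplicity of `P` at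
> `a ∈ 𝔽ⁿ`, denoted `mult(P, a)`, is the largest integer `M` such that for every nonnegative vector
> `i` with `wt(i) < M`, we have `P^{(i)}(a) = 0` (if `M` may be taken arbitrarily large, we set
> `mult(P, a) = ∞`).
>
> (p. 2311) **Proposition 2.3** (basic properties of derivatives). […] 2. If `P(X)` is homogeneous
> of degree `d`, then either `P^{(i)}(X)` is homogeneous of degree `d − wt(i)` or `P^{(i)}(X) = 0`.
> 3. Either `(H_P)^{(i)}(X) = H_{P^{(i)}}(X)` or `(H_P)^{(i)}(X) = 0`.
> 4. `(P^{(i)})^{(j)}(X) = C(i + j, i) P^{(i+j)}(X)`.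
> **Lemma 2.4** (basic properties of multiplicities). If `P(X) ∈ 𝔽[X]` and `a ∈ 𝔽ⁿ` are such that
> `mult(P, a) = m`, then `mult(P^{(i)}, a) ≥ m − wt(i)`.
>
> (p. 2312) **Corollary 2.6.** Let `P(X) ∈ 𝔽[X]`, where `X = (X₁, …, X_n)`. Let `a, b ∈ 𝔽ⁿ`. Let
> `P_{a,b}(T)` be the polynomial `P(a + T · b) ∈ 𝔽[T]`. Then for any `t ∈ 𝔽`,
> `mult(P_{a,b}, t) ≥ mult(P, a + t · b)`.
> **Lemma 2.7.** Let `P ∈ 𝔽[X]` be an `n`-variate nonzero polynomial of total degree at most `d`.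
> Then for any finite `S ⊆ 𝔽`, `∑_{a ∈ Sⁿ} mult(P, a) ≤ d · |S|^{n−1}`.
> (p. 2313) **Corollary 2.8.** Let `P ∈ 𝔽_q[X]` be a polynomial of total degree at most `d`. If
> `∑_{a ∈ 𝔽_qⁿ} mult(P, a) > d · q^{n−1}`, then `P(X) = 0`.
>
> (§3, p. 2314) **Proposition 3.1.** Given a set `K ⊆ 𝔽ⁿ` and nonnegative integers `m, d` such
> that `C(m + n − 1, n) · |K| < C(d + n, n)`, there exists a nonzero polynomial `P = P_{m,K} ∈ 𝔽[X]`
> of total degree at most `d` such that `mult(P, a) ≥ m` for every `a ∈ K`.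
> **Theorem 3.2.** If `K ⊆ 𝔽_qⁿ` is a Kakeya set, then `|K| ≥ (q/(2 − 1/q))ⁿ`.
> *Proof.* Let `ℓ` be a large multiple of `q` and let `m = 2ℓ − ℓ/q`, `d = ℓq − 1`. […]
> (p. 2315) **Claim 3.3.** For each `b ∈ 𝔽_qⁿ`, `mult(H_P, b) ≥ ℓ`. […] Applying Corollary 2.8, and
> noting that `ℓqⁿ > d* q^{n−1}`, we conclude that `H_P(X) = 0`. […] Hence,
> `|K| ≥ C(d + n, n)/C(m + n − 1, n)` […] Since this is true for all `ℓ` such that `ℓ` is a multiple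
> of `q`, we get that `|K| ≥ lim_{ℓ → ∞} ∏ᵢ (q − 1/ℓ + i/ℓ)/(2 − 1/q − 1/ℓ + i/ℓ) = (q/(2 − 1/q))ⁿ`.

## What is proved

* Hasse derivatives on `𝔽[x₁, …, x_n]`.  The notion is the tree's
  `Literature.AlgebraicGeometry.Resolution.hasseDeriv K i f` (the coefficient of `uⁱ` in `f(x + u)`,
  there defined through the Taylor morphism — literally Definition 2.1); here: `mchoose s i`
  (`C(s, i) = ∏ⱼ C(sⱼ, iⱼ)`), `coeff_prod_X_add_C_pow` (the binomial expansion of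
  `∏ⱼ (xⱼ + bⱼ)^{sⱼ}`), **`hasseDeriv_monomial`** (`(x^s)^{(i)} = C(s, i) x^{s−i}`),
  `coeff_hasseDeriv`, **`hasseDeriv_hasseDeriv`** (Proposition 2.3 (4)),
  `homogeneousComponent_hasseDeriv` (Proposition 2.3 (2)–(3), in the form
  `(P^{(i)})_{d'} = (P_{d'+|i|})^{(i)}`), `totalDegree_hasseDeriv_le`, and the **Taylor formula at a
  point** `coeff_shift`: `coeff_i P(x + b) = P^{(i)}(b)` (eq. (2.1) at `X = b`).
* Multiplicity.  `vanishesToOrder_iff_hasseDeriv` — the Saraf–Sudan definition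
  (`VanishesToOrder`, file `KakeyaMultiplicityBound.lean`) agrees with Definition 2.2;
  `mult f b` (def: Definition 2.2 as a number, `le_mult_iff`); **`VanishesToOrder.hasseDeriv`** /
  `mult_sub_le_mult_hasseDeriv` — **Lemma 2.4**; `mult_le_rootMultiplicity` — **Corollary 2.6**.
* **`card_mul_sum_mult_le` — Lemma 2.7 / Corollary 2.8, the multiplicity Schwartz–Zippel lemma**
  (`S = 𝔽_q`): `q · ∑_{b ∈ 𝔽_qⁿ} mult(P, b) ≤ deg P · qⁿ` for `P ≠ 0`; with its inner estimate
  `sum_mult_cons_le` (eq. (2.2): `∑_{b₀} mult(P, (b₀, b')) ≤ t + q · mult(P_t, b')`) and the tool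
  `coeff_finSuccEquiv_hasseDeriv_cons` ("`P^{(i,0)} = ∑ⱼ P_j^{(i)} X_nʲ`").
* `exists_mem_vanishesToOrder`, **`exists_vanishesToOrder_totalDegree_le` — Proposition 3.1**.
* **`vanishesToOrder_homogeneousComponent_of_kakeya` — Claim 3.3**;
  **`choose_le_choose_mul_card_of_isKakeya` — Theorem 3.2 at finite level `ℓ = kq`**:
  `C(kq² − 1 + n, n) ≤ C((2q − 1)k + n − 1, n) · |K|` for every Kakeya set `K ⊆ 𝔽_qⁿ` and every
  `k ≥ 1`; `tendsto_choose_div_choose` (the limit `k → ∞`); **`div_pow_le_card_of_isKakeya` —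
  Theorem 3.2: `(q/(2 − 1/q))ⁿ ≤ |K|`**; **`half_pow_le_card_of_isKakeya`,
  `pow_le_two_pow_mul_card_of_isKakeya` (and `_ncard`) — Theorem 1.1: `(q/2)ⁿ ≤ |K|`,
  `qⁿ ≤ 2ⁿ |K|`.**

The proofs follow the printed ones.  Deviations: Lemma 2.7 is proved for `S = 𝔽_q` only (the
case used, Corollary 2.8) and in the form `q · ∑ mult ≤ d qⁿ`, by the printed induction (the
variable split off is `x₀`, Mathlib's `finSuccEquiv`); `mult(P, b)` is the least degree of a
monomial of `P(x + b)` (so `mult(0, b) = 0` rather than `∞`; every use has `P ≠ 0`); in Claim 3.3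
the coefficient of `T^{d* − w}` (rather than of `T^{deg Q}`) is read off, which is `(H_P)^{(i)}(b)`
in all cases (this is how the printed item 3 of Proposition 2.3 is used).

## Not in this file

* Lemma 2.7 for a general finite `S ⊆ 𝔽`; Proposition 2.5 (multiplicity under composition with a
  polynomial map, of which only the line case Corollary 2.6 is needed); §4 (statistical Kakeya for
  curves), §§5–7 (mergers, extractors, Reed–Solomon list size).
* The sharper bound of Bukh–Chao (`|K| ≥ qⁿ/(2 − 1/q)^{n−1}`).

## References
* [DvirEtAl2013] Z. Dvir, S. Kopparty, S. Saraf, M. Sudan, SIAM J. Comput. 42 (2013), no. 6,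
  2305–2328 — Theorem 1.1 (p. 2307); Definitions 2.1, 2.2 (p. 2310); Proposition 2.3, Lemma 2.4
  (p. 2311); Corollary 2.6, Lemma 2.7 (p. 2312); Corollary 2.8 (p. 2313); Proposition 3.1,
  Theorem 3.2 (p. 2314); Claim 3.3 (p. 2315).  (arXiv:0901.2529 numbers these Definitions 2–3,
  Proposition 4, Lemma 5, Corollary 7, Lemma 8, Corollary 9, Proposition 10, Theorem 11, Claim 12.)
* [SarafSudan2008KakeyaFiniteFields] — the shift `g(x + a)` and the notion "zero of multiplicity
  `m`" (`shift`, `VanishesToOrder`, file `KakeyaMultiplicityBound.lean`).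
* [VillamayorU2008ReesDiff], [EGAIV4] — the Taylor morphism and Hasse–Schmidt derivatives as
  formalized in `Literature.AlgebraicGeometry.Resolution.HasseSchmidtDerivatives`.
-/

namespace Literature.Combinatorics.Kakeya

namespace FiniteFieldKakeya

open MvPolynomial Finset
open Literature.AlgebraicGeometry.Resolution (taylor hasseDeriv hasseDeriv_apply
  hasseDeriv_zero_apply)

variable {K : Type*} [Field K]

/-! ### Hasse derivatives (Dvir–Kopparty–Saraf–Sudan §2) -/

section Hasse

variable {n : ℕ}

/-- The multi-index binomial coefficient `C(s, i) = ∏ⱼ C(sⱼ, iⱼ)` ("`{i choose j} = ∏ₖ C(iₖ, jₖ)`",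
DKSS §2.1). [cite: DvirEtAl2013, §2.1 (notation, p. 2310)] -/
def mchoose (s i : Fin n →₀ ℕ) : ℕ :=
  ∏ j, (s j).choose (i j)

/-- `C(s, i) = 0` unless `i ≤ s`. [folklore] -/
theorem mchoose_eq_zero {s i : Fin n →₀ ℕ} (h : ¬ i ≤ s) : mchoose s i = 0 := by
  rw [Finsupp.le_def] at h
  push Not at h
  obtain ⟨j, hj⟩ := h
  exact Finset.prod_eq_zero (Finset.mem_univ j) (Nat.choose_eq_zero_of_lt hj)

/-- `C(s, 0) = 1`. [folklore] -/
@[simp] theorem mchoose_zero_right (s : Fin n →₀ ℕ) : mchoose s 0 = 1 := by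
  simp [mchoose]

/-- `C(s, s) = 1`. [folklore] -/
@[simp] theorem mchoose_self (s : Fin n →₀ ℕ) : mchoose s s = 1 := by
  simp [mchoose]

/-! #### The binomial expansion of a shifted monomial -/

/-- A finite product of monomials is a monomial. [folklore] -/
theorem prod_monomial_eq {R : Type*} [CommSemiring R] {ι : Type*} (t : Finset ι)
    (e : ι → (Fin n →₀ ℕ)) (r : ι → R) :
    ∏ x ∈ t, monomial (e x) (r x) = monomial (∑ x ∈ t, e x) (∏ x ∈ t, r x) := by
  classical
  induction t using Finset.induction_on with
  | empty => simp
  | insert a t ha ih =>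
    rw [Finset.prod_insert ha, Finset.prod_insert ha, Finset.sum_insert ha, ih, monomial_mul]

/-- The binomial expansion of a shifted monomial: the coefficient of `xⁱ` in
`∏ⱼ (xⱼ + bⱼ)^{sⱼ}` is `∏ⱼ C(sⱼ, iⱼ) bⱼ^{sⱼ − iⱼ}` ("the coefficient of `Zⁱ W^{r−i}` in the
expansion of `(Z + W)^r` equals `C(r, i)`", DKSS §2.1), over any commutative ring. [folklore] -/
theorem coeff_prod_X_add_C_pow {R : Type*} [CommRing R] (b : Fin n → R) (s i : Fin n →₀ ℕ) :
    coeff i (∏ j, (X j + C (b j)) ^ (s j) : MvPolynomial (Fin n) R) =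
      ∏ j, (((s j).choose (i j) : R) * b j ^ (s j - i j)) := by
  classical
  -- expand each factor by the binomial theorem, as a sum of monomials in `xⱼ`
  have hfac : ∀ j : Fin n, (X j + C (b j)) ^ (s j) =
      ∑ l ∈ Finset.range (s j + 1), monomial (Finsupp.single j l)
        (((s j).choose l : R) * b j ^ (s j - l)) := by
    intro j
    rw [add_pow]
    refine Finset.sum_congr rfl fun l _ => ?_
    rw [X_pow_eq_monomial, ← map_pow, ← map_natCast (C : R →+* MvPolynomial (Fin n) R),
      mul_assoc, ← map_mul, mul_comm (monomial _ _), C_mul_monomial, mul_one, mul_comm]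
  simp_rw [hfac]
  rw [Finset.prod_univ_sum]
  -- each summand is a single monomial
  have hterm : ∀ l : Fin n → ℕ,
      (∏ j, monomial (Finsupp.single j (l j)) (((s j).choose (l j) : R) * b j ^ (s j - l j))) =
        monomial (Finsupp.equivFunOnFinite.symm l)
          (∏ j, (((s j).choose (l j) : R) * b j ^ (s j - l j))) := by
    intro l
    rw [prod_monomial_eq]
    congr 1
    conv_rhs => rw [← Finsupp.univ_sum_single (Finsupp.equivFunOnFinite.symm l)]
    simp only [Finsupp.coe_equivFunOnFinite_symm]
  simp_rw [hterm]
  rw [coeff_sum]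
  simp_rw [coeff_monomial]
  have hiff : ∀ l : Fin n → ℕ, Finsupp.equivFunOnFinite.symm l = i ↔ l = ⇑i := by
    intro l
    rw [Equiv.symm_apply_eq]
    rfl
  simp_rw [hiff]
  rw [Finset.sum_ite_eq']
  split_ifs with hmem
  · rfl
  · -- some `i j > s j`: the right-hand side vanishes
    rw [Fintype.mem_piFinset] at hmem
    push Not at hmem
    obtain ⟨j, hj⟩ := hmem
    rw [Finset.mem_range, not_lt] at hj
    symm
    exact Finset.prod_eq_zero (Finset.mem_univ j)
      (by rw [Nat.choose_eq_zero_of_lt (by omega), Nat.cast_zero, zero_mul])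

/-! #### Hasse derivatives: the binomial formula and its consequences

The Hasse(–Schmidt) derivative `hasseDeriv K i f` — the coefficient of `uⁱ` in `f(x + u)` — is
the tree's `Literature.AlgebraicGeometry.Resolution.hasseDeriv` (defined there through the
Taylor morphism `taylor K : f ↦ f(x + u)`, for any commutative ring); this is literally DKSS
Definition 2.1.  What follows is its calculus on `𝔽[x₁, …, x_n]` as used by DKSS: the binomial
formula on monomials, the coefficient formula, derivatives of derivatives, homogeneous parts,
and the Taylor formula at a point. -/

/-- **The Hasse derivative of a monomial: `(c x^s)^{(i)} = C(s, i) c x^{s − i}`** (DKSS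
Definition 2.1 with "the coefficient of `Zⁱ W^{r−i}` in `(Z + W)^r` equals `C(r, i)`").
[cite: DvirEtAl2013, Definition 2.1 (§2.1, p. 2310)] -/
theorem hasseDeriv_monomial (i s : Fin n →₀ ℕ) (c : K) :
    hasseDeriv K i (monomial s c) = monomial (s - i) ((mchoose s i : K) * c) := by
  classical
  rw [hasseDeriv_apply, taylor, aeval_monomial, Finsupp.prod_fintype _ _ (fun j => pow_zero _),
    MvPolynomial.algebraMap_apply, MvPolynomial.algebraMap_eq, coeff_C_mul]
  have hcomm : (∏ j, (C (X j) + X j : MvPolynomial (Fin n) (MvPolynomial (Fin n) K)) ^ (s j)) =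
      ∏ j, (X j + C (X j)) ^ (s j) :=
    Finset.prod_congr rfl fun j _ => by rw [add_comm]
  rw [hcomm, coeff_prod_X_add_C_pow (R := MvPolynomial (Fin n) K) (fun j => X j) s i,
    Finset.prod_mul_distrib, ← Nat.cast_prod, ← map_natCast (C : K →+* MvPolynomial (Fin n) K),
    ← mul_assoc, ← map_mul, monomial_eq, Finsupp.prod_fintype _ _ (fun j => pow_zero _)]
  congr 1
  rw [mul_comm]
  rfl

/-- The Hasse derivative as an explicit sum over the monomials of `f`. [folklore] -/
theorem hasseDeriv_eq_sum (i : Fin n →₀ ℕ) (f : MvPolynomial (Fin n) K) :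
    hasseDeriv K i f = ∑ s ∈ f.support, monomial (s - i) ((mchoose s i : K) * coeff s f) := by
  conv_lhs => rw [f.as_sum]
  rw [map_sum]
  exact Finset.sum_congr rfl fun s _ => hasseDeriv_monomial i s _

/-- **The coefficients of a Hasse derivative:** `coeff_a P^{(i)} = C(a + i, i) · coeff_{a+i} P`.
[folklore] -/
theorem coeff_hasseDeriv (i a : Fin n →₀ ℕ) (f : MvPolynomial (Fin n) K) :
    coeff a (hasseDeriv K i f) = (mchoose (a + i) i : K) * coeff (a + i) f := by
  classical
  rw [hasseDeriv_eq_sum, coeff_sum]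
  simp_rw [coeff_monomial]
  rw [Finset.sum_eq_single (a + i)]
  · rw [if_pos (add_tsub_cancel_right a i)]
  · intro s _ hne
    split_ifs with h
    · have hle : ¬ i ≤ s := fun hle => hne (by rw [← h, tsub_add_cancel_of_le hle])
      rw [mchoose_eq_zero hle, Nat.cast_zero, zero_mul]
    · rfl
  · intro hnot
    rw [if_pos (add_tsub_cancel_right a i), notMem_support_iff.1 hnot, mul_zero]

/-- The Hasse derivative commutes with constants. [folklore] -/
theorem hasseDeriv_C_mul (i : Fin n →₀ ℕ) (c : K) (f : MvPolynomial (Fin n) K) :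
    hasseDeriv K i (C c * f) = C c * hasseDeriv K i f := by
  ext a
  simp only [coeff_hasseDeriv, coeff_C_mul]
  ring

/-- The support of `P^{(i)}` consists of exponents `a` with `a + i` in the support of `P`; in
particular `P^{(i)}` lowers every degree by exactly `|i|` (DKSS Proposition 2.3 (2): if `P` is
homogeneous of degree `d` then `P^{(i)}` is homogeneous of degree `d − |i|`). [folklore] -/
theorem add_mem_support_of_mem_support_hasseDeriv {i a : Fin n →₀ ℕ} {f : MvPolynomial (Fin n) K}
    (h : a ∈ (hasseDeriv K i f).support) : a + i ∈ f.support := by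
  rw [mem_support_iff, coeff_hasseDeriv] at h
  rw [mem_support_iff]
  exact fun h0 => h (by rw [h0, mul_zero])

/-- `deg P^{(i)} + |i| ≤ deg P` on the support: every monomial of `P^{(i)}` has degree at most
`deg P − |i|`. [folklore] -/
theorem totalDegree_hasseDeriv_le (i : Fin n →₀ ℕ) (f : MvPolynomial (Fin n) K) :
    (hasseDeriv K i f).totalDegree ≤ f.totalDegree - i.degree := by
  rw [totalDegree]
  refine Finset.sup_le fun a ha => ?_
  have h := le_totalDegree (add_mem_support_of_mem_support_hasseDeriv ha)
  have hdeg : ((a + i).sum fun _ e => e) = (a.sum fun _ e => e) + (i.sum fun _ e => e) :=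
    Finsupp.sum_add_index' (fun _ => rfl) (fun _ _ _ => rfl)
  rw [hdeg] at h
  have : (i.sum fun _ e => e) = i.degree := by
    rw [Finsupp.degree_apply]
    rfl
  omega

/-- **Derivatives of derivatives** (DKSS Proposition 2.3 (4)):
`(P^{(i)})^{(e)} = C(e + i, i) · P^{(e + i)}`.
[cite: DvirEtAl2013, Proposition 2.3 (4) (§2.2, p. 2311)] -/
theorem hasseDeriv_hasseDeriv (e i : Fin n →₀ ℕ) (f : MvPolynomial (Fin n) K) :
    hasseDeriv K e (hasseDeriv K i f) = C (mchoose (e + i) i : K) * hasseDeriv K (e + i) f := by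
  ext a
  rw [coeff_hasseDeriv, coeff_hasseDeriv, coeff_C_mul, coeff_hasseDeriv, ← add_assoc, ← mul_assoc,
    ← mul_assoc]
  congr 1
  rw [← Nat.cast_mul, ← Nat.cast_mul]
  congr 1
  -- `C(a + e, e) C(a + e + i, i) = C(e + i, i) C(a + e + i, e + i)`, coordinatewise
  rw [mchoose, mchoose, mchoose, mchoose, ← Finset.prod_mul_distrib, ← Finset.prod_mul_distrib]
  refine Finset.prod_congr rfl fun j _ => ?_
  simp only [Finsupp.coe_add, Pi.add_apply]
  have h := Nat.choose_mul (n := a j + e j + i j) (k := e j + i j) (s := i j) (by omega)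
  -- h : C(n, e+i) * C(e+i, i) = C(n, i) * C(n - i, e + i - i)
  rw [show a j + e j + i j - i j = a j + e j by omega, show e j + i j - i j = e j by omega] at h
  rw [mul_comm ((a j + e j).choose (e j))]
  linarith [h]

/-- `P^{(i)}` of the homogeneous component: `(P^{(i)})_{d'} = (P_{d' + |i|})^{(i)}` — in
particular the top homogeneous part of `P^{(i)}` in degree `deg P − |i|` is `(H_P)^{(i)}`
(DKSS Proposition 2.3 (2)–(3)). [cite: DvirEtAl2013, Proposition 2.3
(2)–(3) (§2.2, p. 2311)] -/
theorem homogeneousComponent_hasseDeriv (i : Fin n →₀ ℕ) (d' : ℕ) (f : MvPolynomial (Fin n) K) :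
    homogeneousComponent d' (hasseDeriv K i f) =
      hasseDeriv K i (homogeneousComponent (d' + i.degree) f) := by
  classical
  ext a
  rw [coeff_homogeneousComponent, coeff_hasseDeriv, coeff_hasseDeriv, coeff_homogeneousComponent,
    map_add]
  by_cases h : a.degree = d'
  · rw [if_pos h, if_pos (by rw [h])]
  · rw [if_neg h, if_neg (fun h' => h (by omega)), mul_zero]

/-! #### The Taylor formula `P(x + b) = ∑ᵢ P^{(i)}(b) xⁱ` -/

/-- The shift of a monomial: `(c x^s)(x + b) = c ∏ⱼ (xⱼ + bⱼ)^{sⱼ}`. [folklore] -/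
theorem shift_monomial (b : Fin n → K) (s : Fin n →₀ ℕ) (c : K) :
    shift b (monomial s c) = C c * ∏ j, (X j + C (b j)) ^ (s j) := by
  rw [shift_eq, aeval_monomial, algebraMap_eq, Finsupp.prod_fintype _ _ fun j => pow_zero _]

/-- **Taylor's formula** (DKSS eq. (2.1), `P(X + Z) = ∑ᵢ P^{(i)}(X) Zⁱ`, read coefficientwise
at `X = b`): the coefficient of `xⁱ` in `P(x + b)` is `P^{(i)}(b)`.
[cite: DvirEtAl2013, Definition 2.1 / eq. (2.1) (§2.1, p. 2310)] -/
theorem coeff_shift (b : Fin n → K) (i : Fin n →₀ ℕ) (f : MvPolynomial (Fin n) K) :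
    coeff i (shift b f) = eval b (hasseDeriv K i f) := by
  classical
  induction f using MvPolynomial.induction_on' with
  | monomial s c =>
    rw [shift_monomial, coeff_C_mul, coeff_prod_X_add_C_pow, hasseDeriv_monomial, eval_monomial,
      Finsupp.prod_fintype _ _ fun j => pow_zero _, mchoose, Nat.cast_prod, Finset.prod_mul_distrib]
    simp_rw [Finsupp.tsub_apply]
    ring
  | add p q hp hq =>
    rw [shift_eq, map_add, coeff_add, ← shift_eq, ← shift_eq, hp, hq, map_add, map_add]

/-- `P` has a zero of multiplicity `m` at `b` iff `P^{(i)}(b) = 0` for all `|i| < m`: the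
Saraf–Sudan definition of multiplicity (`VanishesToOrder`, via the support of `P(x + b)`) agrees
with DKSS Definition 2.2 (via Hasse derivatives). [cite: DvirEtAl2013,
Definition 2.2 (§2.1, p. 2310)] -/
theorem vanishesToOrder_iff_hasseDeriv (f : MvPolynomial (Fin n) K) (b : Fin n → K) (m : ℕ) :
    VanishesToOrder f b m ↔ ∀ i : Fin n →₀ ℕ, i.degree < m → eval b (hasseDeriv K i f) = 0 := by
  constructor
  · intro h i hi
    rw [← coeff_shift]
    by_contra hne
    exact absurd (h i (mem_support_iff.2 hne)) (not_le.2 hi)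
  · intro h i hi
    by_contra hlt
    rw [mem_support_iff, coeff_shift] at hi
    exact hi (h i (not_le.1 hlt))

/-- **DKSS Lemma 2.4** (basic property of multiplicities): if `P` has a zero of multiplicity `m`
at `b` then `P^{(i)}` has a zero of multiplicity `m − |i|` at `b`.
[cite: DvirEtAl2013, Lemma 2.4 (§2.3, p. 2311)] -/
theorem VanishesToOrder.hasseDeriv {f : MvPolynomial (Fin n) K} {b : Fin n → K} {m : ℕ}
    (h : VanishesToOrder f b m) (i : Fin n →₀ ℕ) :
    VanishesToOrder (hasseDeriv K i f) b (m - i.degree) := by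
  rw [vanishesToOrder_iff_hasseDeriv] at h ⊢
  intro e he
  rw [hasseDeriv_hasseDeriv, map_mul, h (e + i) (by rw [map_add]; omega), mul_zero]

end Hasse

/-! ### Multiplicity as a number; the multiplicity Schwartz–Zippel lemma (DKSS §§2.3–2.4) -/

section Multiplicity

variable {n : ℕ}

/-- Shifting twice. [folklore] -/
theorem shift_shift (b c : Fin n → K) (f : MvPolynomial (Fin n) K) :
    shift c (shift b f) = shift (b + c) f := by
  have h := comp_aeval (R := K) (f := fun i => X i + C (b i))
    (aeval (R := K) fun i => (X i + C (c i) : MvPolynomial (Fin n) K))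
  have hg := AlgHom.congr_fun h f
  rw [AlgHom.comp_apply] at hg
  rw [shift_eq, shift_eq, hg, shift_eq]
  have hfun : (fun i => aeval (R := K) (fun i => (X i + C (c i) : MvPolynomial (Fin n) K))
      (X i + C (b i))) = fun i => (X i + C ((b + c) i) : MvPolynomial (Fin n) K) := by
    funext i
    simp only [map_add, aeval_X, aeval_C, algebraMap_eq, Pi.add_apply]
    ring
  rw [hfun]

/-- `shift 0 = id`. [folklore] -/
@[simp] theorem shift_zero' (f : MvPolynomial (Fin n) K) : shift 0 f = f := by
  rw [shift_eq]
  have hfun : (fun i => (X i + C ((0 : Fin n → K) i) : MvPolynomial (Fin n) K)) = X := by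
    funext i
    simp
  rw [hfun]
  exact aeval_X_left_apply f

/-- A shift of a nonzero polynomial is nonzero. [folklore] -/
theorem shift_ne_zero {f : MvPolynomial (Fin n) K} (hf : f ≠ 0) (b : Fin n → K) :
    shift b f ≠ 0 := by
  intro h
  apply hf
  have := shift_shift b (-b) f
  rw [h, add_neg_cancel, shift_zero', shift_eq, map_zero] at this
  exact this.symm

/-- **The multiplicity `mult(P, b)`** (DKSS Definition 2.2): the least degree of a monomial of
`P(x + b)`, i.e. the largest `M` with `P^{(i)}(b) = 0` for all `|i| < M` (`le_mult_iff`); by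
convention `0` for `P = 0` (DKSS set `∞` there; all uses below have `P ≠ 0`).
[cite: DvirEtAl2013, Definition 2.2 (§2.1, p. 2310)] -/
noncomputable def mult (f : MvPolynomial (Fin n) K) (b : Fin n → K) : ℕ :=
  sInf (Finsupp.degree '' ((shift b f).support : Set (Fin n →₀ ℕ)))

/-- `P` vanishes to order `mult(P, b)` at `b`. [folklore] -/
theorem vanishesToOrder_mult (f : MvPolynomial (Fin n) K) (b : Fin n → K) :
    VanishesToOrder f b (mult f b) :=
  fun s hs => Nat.sInf_le ⟨s, hs, rfl⟩

/-- For `P ≠ 0` the multiplicity is attained: some monomial of `P(x + b)` has degree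
`mult(P, b)`. [folklore] -/
theorem exists_degree_eq_mult {f : MvPolynomial (Fin n) K} (hf : f ≠ 0) (b : Fin n → K) :
    ∃ s ∈ (shift b f).support, s.degree = mult f b := by
  have hne : (Finsupp.degree '' ((shift b f).support : Set (Fin n →₀ ℕ))).Nonempty := by
    obtain ⟨s, hs⟩ := support_nonempty.2 (shift_ne_zero hf b)
    exact ⟨s.degree, s, hs, rfl⟩
  obtain ⟨s, hs, hsd⟩ := Nat.sInf_mem hne
  exact ⟨s, hs, hsd⟩

/-- For `P ≠ 0`: `M ≤ mult(P, b)` iff `P` vanishes to order `M` at `b` (DKSS Definition 2.2: the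
multiplicity is the largest such `M`). [cite: DvirEtAl2013,
Definition 2.2 (§2.1, p. 2310)] -/
theorem le_mult_iff {f : MvPolynomial (Fin n) K} (hf : f ≠ 0) {b : Fin n → K} {M : ℕ} :
    M ≤ mult f b ↔ VanishesToOrder f b M := by
  constructor
  · intro h s hs
    exact h.trans (vanishesToOrder_mult f b s hs)
  · intro h
    obtain ⟨s, hs, hsd⟩ := exists_degree_eq_mult hf b
    rw [← hsd]
    exact h s hs

/-- In dimension `0` every multiplicity is `0`. [folklore] -/
theorem mult_eq_zero_of_isEmpty {f : MvPolynomial (Fin 0) K} (hf : f ≠ 0) (b : Fin 0 → K) :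
    mult f b = 0 := by
  obtain ⟨s, _, hsd⟩ := exists_degree_eq_mult hf b
  rw [← hsd, Subsingleton.elim s 0, map_zero]

/-- **DKSS Lemma 2.4 for `mult`:** `mult(P^{(i)}, b) ≥ mult(P, b) − |i|` (for `P^{(i)} ≠ 0`).
[cite: DvirEtAl2013, Lemma 2.4 (§2.3, p. 2311)] -/
theorem mult_sub_le_mult_hasseDeriv {f : MvPolynomial (Fin n) K} (i : Fin n →₀ ℕ)
    (hfi : hasseDeriv K i f ≠ 0) (b : Fin n → K) :
    mult f b - i.degree ≤ mult (hasseDeriv K i f) b :=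
  (le_mult_iff hfi).2 ((vanishesToOrder_mult f b).hasseDeriv i)

/-- **DKSS Corollary 2.6 (Proposition 4 of Saraf–Sudan) for `mult`:** the restriction of `P` to the
line `a + tb` has a root of multiplicity at least `mult(P, a + t₀ b)` at `t₀` (when the
restriction is nonzero). [cite: DvirEtAl2013, Corollary 2.6 (§2.3, p. 2312)] -/
theorem mult_le_rootMultiplicity (a b : Fin n → K) (t₀ : K) (f : MvPolynomial (Fin n) K)
    (hL : aeval (fun i => Polynomial.C (a i) + Polynomial.C (b i) * Polynomial.X) f ≠ 0) :
    mult f (a + t₀ • b) ≤ Polynomial.rootMultiplicity t₀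
      (aeval (fun i => Polynomial.C (a i) + Polynomial.C (b i) * Polynomial.X) f) :=
  (Polynomial.le_rootMultiplicity_iff hL).2
    (X_sub_C_pow_dvd_aeval_line a b t₀ f (vanishesToOrder_mult f _))

/-! #### Hasse derivatives in the last `n` variables and the expansion in the first one -/

/-- `C(cons j m + cons 0 e, cons 0 e) = C(m + e, e)`: a derivative not involving the first variable.
[folklore] -/
theorem mchoose_cons (j : ℕ) (m e : Fin n →₀ ℕ) :
    mchoose (Finsupp.cons j m + Finsupp.cons 0 e) (Finsupp.cons 0 e) = mchoose (m + e) e := by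
  rw [mchoose, mchoose, Fin.prod_univ_succ]
  simp only [Finsupp.coe_add, Pi.add_apply, Finsupp.cons_zero, Finsupp.cons_succ, add_zero,
    Nat.choose_zero_right, one_mul]

/-- `cons j m + cons 0 e = cons j (m + e)`. [folklore] -/
theorem cons_add_cons_zero (j : ℕ) (m e : Fin n →₀ ℕ) :
    Finsupp.cons j m + Finsupp.cons 0 e = Finsupp.cons j (m + e) := by
  ext k
  refine Fin.cases ?_ (fun l => ?_) k
  · simp only [Finsupp.coe_add, Pi.add_apply, Finsupp.cons_zero, add_zero]
  · simp only [Finsupp.coe_add, Pi.add_apply, Finsupp.cons_succ]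

/-- **"`P^{(i, 0)} = ∑ⱼ P_j^{(i)} X_n^j`"** (proof of DKSS Lemma 2.7): a Hasse derivative in the
variables `x₁, …, x_n` acts coefficientwise on the expansion of `P` in powers of `x₀`.
[cite: DvirEtAl2013, Lemma 2.7 (proof, §2.4, p. 2313)] -/
theorem coeff_finSuccEquiv_hasseDeriv_cons (e : Fin n →₀ ℕ) (f : MvPolynomial (Fin (n + 1)) K)
    (j : ℕ) :
    Polynomial.coeff (finSuccEquiv K n (hasseDeriv K (Finsupp.cons 0 e) f)) j =
      hasseDeriv K e (Polynomial.coeff (finSuccEquiv K n f) j) := by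
  ext m
  rw [finSuccEquiv_coeff_coeff, coeff_hasseDeriv, coeff_hasseDeriv, finSuccEquiv_coeff_coeff,
    mchoose_cons, cons_add_cons_zero]

/-- The restriction of `F` to the line `t ↦ (t, b')` (through `(0, b')` in direction `e₀`) is the
specialisation at `b'` of the expansion of `F` in powers of `x₀`. [folklore] -/
theorem aeval_line_cons (b' : Fin n → K) (F : MvPolynomial (Fin (n + 1)) K) :
    aeval (fun k => Polynomial.C ((Fin.cons 0 b' : Fin (n + 1) → K) k) +
      Polynomial.C ((Fin.cons 1 0 : Fin (n + 1) → K) k) * Polynomial.X) F =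
      Polynomial.map (eval b') (finSuccEquiv K n F) := by
  set φ : MvPolynomial (Fin (n + 1)) K →ₐ[K] Polynomial K :=
    (Polynomial.mapAlgHom (aeval b')).comp (finSuccEquiv K n).toAlgHom with hφ
  have hφF : φ F = Polynomial.map (eval b') (finSuccEquiv K n F) := by
    rw [hφ, AlgHom.comp_apply, Polynomial.coe_mapAlgHom]
    rfl
  rw [← hφF]
  refine AlgHom.congr_fun (algHom_ext fun k => ?_) F
  rw [hφ, AlgHom.comp_apply, Polynomial.coe_mapAlgHom, aeval_X]
  refine Fin.cases ?_ (fun l => ?_) k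
  · show _ = Polynomial.map (eval b') (finSuccEquiv K n (X 0))
    rw [finSuccEquiv_X_zero, Polynomial.map_X]
    simp only [Fin.cons_zero, map_zero, map_one, one_mul, zero_add]
  · show _ = Polynomial.map (eval b') (finSuccEquiv K n (X l.succ))
    rw [finSuccEquiv_X_succ, Polynomial.map_C, eval_X]
    simp only [Fin.cons_succ, Pi.zero_apply, map_zero, zero_mul, add_zero]

/-- The point `(b₀, b')` on that line. [folklore] -/
theorem cons_zero_add_smul_cons_one (b₀ : K) (b' : Fin n → K) :
    (Fin.cons 0 b' : Fin (n + 1) → K) + b₀ • (Fin.cons 1 0 : Fin (n + 1) → K) = Fin.cons b₀ b' := by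
  ext k
  refine Fin.cases ?_ (fun l => ?_) k
  · simp
  · simp

/-- The sum of the root multiplicities of a nonzero univariate polynomial over all points of a
finite field is at most its degree (the case `n = 1` of DKSS Lemma 2.7).
[cite: DvirEtAl2013, Lemma 2.7 (case n = 1, §2.4, p. 2312)] -/
theorem sum_rootMultiplicity_le [Fintype K] [DecidableEq K] (g : Polynomial K) :
    ∑ t : K, g.rootMultiplicity t ≤ g.natDegree := by
  calc ∑ t : K, g.rootMultiplicity t = ∑ t : K, g.roots.count t :=
      Finset.sum_congr rfl fun t _ => (Polynomial.count_roots g).symm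
    _ = Multiset.card g.roots := Multiset.sum_count_eq_card fun _ _ => Finset.mem_univ _
    _ ≤ g.natDegree := Polynomial.card_roots' g

/-- **The inner estimate of DKSS Lemma 2.7 (eq. (2.2)):** writing `P = ∑_{j ≤ t} P_j(x') x₀^j` with
`P_t ≠ 0`, for every `b'`: `∑_{b₀ ∈ 𝔽} mult(P, (b₀, b')) ≤ t + q · mult(P_t, b')`.
[cite: DvirEtAl2013, Lemma 2.7 (proof, eq. (2.2), §2.4, p. 2313)] -/
theorem sum_mult_cons_le [Fintype K] {f : MvPolynomial (Fin (n + 1)) K} (hf : f ≠ 0)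
    (b' : Fin n → K) :
    ∑ b₀ : K, mult f (Fin.cons b₀ b') ≤ (finSuccEquiv K n f).natDegree +
      Fintype.card K * mult (finSuccEquiv K n f).leadingCoeff b' := by
  classical
  set P := finSuccEquiv K n f with hP
  set t := P.natDegree with ht
  have hP0 : P ≠ 0 := by
    rw [hP]
    exact (EmbeddingLike.map_ne_zero_iff (f := finSuccEquiv K n)).2 hf
  have hPt : P.leadingCoeff ≠ 0 := Polynomial.leadingCoeff_ne_zero.2 hP0
  set m' := mult P.leadingCoeff b' with hm'
  -- a derivative `e` of weight `m'` with `P_t^{(e)}(b') ≠ 0`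
  obtain ⟨e, he, hedeg⟩ := exists_degree_eq_mult hPt b'
  have hev : eval b' (hasseDeriv K e P.leadingCoeff) ≠ 0 := by
    rw [← coeff_shift]
    exact mem_support_iff.1 he
  -- the polynomial `g(x₀) = P^{(0, e)}(x₀, b')`, nonzero of degree `≤ t`
  set F := hasseDeriv K (Finsupp.cons 0 e) f with hF
  set g := Polynomial.map (eval b') (finSuccEquiv K n F) with hg
  have hgcoeff : ∀ j, g.coeff j = eval b' (hasseDeriv K e (P.coeff j)) := by
    intro j
    rw [hg, Polynomial.coeff_map, hF, coeff_finSuccEquiv_hasseDeriv_cons]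
  have hgt : g.coeff t ≠ 0 := by
    rw [hgcoeff, ht, Polynomial.coeff_natDegree]
    exact hev
  have hg0 : g ≠ 0 := fun h => hgt (by rw [h, Polynomial.coeff_zero])
  have hgdeg : g.natDegree ≤ t := by
    refine Polynomial.natDegree_le_iff_coeff_eq_zero.2 fun N hN => ?_
    rw [hgcoeff, Polynomial.coeff_eq_zero_of_natDegree_lt hN, map_zero, map_zero]
  -- each `mult(P, (b₀, b'))` is at most `m' + (multiplicity of b₀ as a root of g)`
  have hpt : ∀ b₀ : K, mult f (Fin.cons b₀ b') ≤ m' + g.rootMultiplicity b₀ := by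
    intro b₀
    have hdeg_e : (Finsupp.cons 0 e : Fin (n + 1) →₀ ℕ).degree = m' := by
      -- `|(0, e)| = 0 + |e|` (the tree's `degree_cons`, inlined)
      have hdc : (Finsupp.cons 0 e : Fin (n + 1) →₀ ℕ).degree = 0 + e.degree := by
        rw [Finsupp.degree_eq_sum, Finsupp.degree_eq_sum, Fin.sum_univ_succ]
        simp only [Finsupp.cons_zero, Finsupp.cons_succ]
      rw [hdc, zero_add, hedeg]
    by_cases hF0 : F = 0
    · -- then `g = 0`, impossible
      exfalso
      apply hg0
      rw [hg, hF0, map_zero, Polynomial.map_zero]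
    have h1 := mult_sub_le_mult_hasseDeriv (Finsupp.cons 0 e) hF0 (Fin.cons b₀ b')
    rw [hdeg_e, ← hF] at h1
    have hL : aeval (fun k => Polynomial.C ((Fin.cons 0 b' : Fin (n + 1) → K) k) +
        Polynomial.C ((Fin.cons 1 0 : Fin (n + 1) → K) k) * Polynomial.X) F ≠ 0 := by
      rw [aeval_line_cons, ← hg]
      exact hg0
    have h2 := mult_le_rootMultiplicity (Fin.cons 0 b') (Fin.cons 1 0) b₀ F hL
    rw [cons_zero_add_smul_cons_one, aeval_line_cons, ← hg] at h2
    omega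
  calc ∑ b₀ : K, mult f (Fin.cons b₀ b') ≤ ∑ b₀ : K, (m' + g.rootMultiplicity b₀) :=
      Finset.sum_le_sum fun b₀ _ => hpt b₀
    _ = Fintype.card K * m' + ∑ b₀ : K, g.rootMultiplicity b₀ := by
      rw [Finset.sum_add_distrib, Finset.sum_const, Finset.card_univ, smul_eq_mul]
    _ ≤ Fintype.card K * m' + t := Nat.add_le_add_left ((sum_rootMultiplicity_le g).trans hgdeg) _
    _ = t + Fintype.card K * m' := add_comm _ _

/-- **The multiplicity Schwartz–Zippel lemma** (DKSS Lemma 2.7 with `S = 𝔽_q`, Corollary 2.8): for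
a nonzero `P ∈ 𝔽_q[x₁, …, x_n]` of total degree `d`,
`∑_{b ∈ 𝔽_qⁿ} mult(P, b) ≤ d · q^{n−1}` — stated as `q · ∑_b mult(P, b) ≤ d · qⁿ`.
[cite: DvirEtAl2013, Lemma 2.7 / Corollary 2.8 (§2.4, pp. 2312–2313)] -/
theorem card_mul_sum_mult_le [Fintype K] :
    ∀ {n : ℕ} (f : MvPolynomial (Fin n) K), f ≠ 0 →
      Fintype.card K * ∑ b : Fin n → K, mult f b ≤ f.totalDegree * Fintype.card K ^ n
  | 0, f, hf => by
    rw [Finset.sum_eq_zero fun b _ => mult_eq_zero_of_isEmpty hf b, mul_zero]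
    exact Nat.zero_le _
  | n + 1, f, hf => by
    classical
    set P := finSuccEquiv K n f with hP
    set t := P.natDegree with ht
    set q := Fintype.card K with hq
    have hP0 : P ≠ 0 := (EmbeddingLike.map_ne_zero_iff (f := finSuccEquiv K n)).2 hf
    have hPt : P.leadingCoeff ≠ 0 := Polynomial.leadingCoeff_ne_zero.2 hP0
    have hdegt : P.leadingCoeff.totalDegree + t ≤ f.totalDegree := by
      have h := totalDegree_coeff_finSuccEquiv_add_le f t
        (by rw [← hP, ht, Polynomial.coeff_natDegree]; exact hPt)
      rw [← hP, ht, Polynomial.coeff_natDegree] at h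
      rw [ht]
      exact h
    -- induction hypothesis for the leading coefficient `P_t`
    have IH := card_mul_sum_mult_le P.leadingCoeff hPt
    -- reindex the sum over `𝔽ⁿ⁺¹` as a double sum
    have hsum : ∑ b : Fin (n + 1) → K, mult f b =
        ∑ b' : Fin n → K, ∑ b₀ : K, mult f (Fin.cons b₀ b') := by
      rw [← Fintype.sum_equiv (Fin.consEquiv fun _ : Fin (n + 1) => K)
        (fun p => mult f (Fin.cons p.1 p.2)) (fun b => mult f b) (fun p => rfl),
        Fintype.sum_prod_type, Finset.sum_comm]
    rw [hsum]
    calc q * ∑ b' : Fin n → K, ∑ b₀ : K, mult f (Fin.cons b₀ b')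
        ≤ q * ∑ b' : Fin n → K, (t + q * mult P.leadingCoeff b') :=
          Nat.mul_le_mul_left _ (Finset.sum_le_sum fun b' _ => sum_mult_cons_le hf b')
      _ = q ^ (n + 1) * t + q * (q * ∑ b' : Fin n → K, mult P.leadingCoeff b') := by
          rw [Finset.sum_add_distrib, Finset.sum_const, Finset.card_univ, Fintype.card_fun,
            Fintype.card_fin, smul_eq_mul, ← Finset.mul_sum]
          ring
      _ ≤ q ^ (n + 1) * t + q * (P.leadingCoeff.totalDegree * q ^ n) :=
          Nat.add_le_add_left (Nat.mul_le_mul_left _ IH) _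
      _ ≤ q ^ (n + 1) * t + q * ((f.totalDegree - t) * q ^ n) := by
          gcongr
          omega
      _ = f.totalDegree * q ^ (n + 1) := by
          have : t ≤ f.totalDegree := by omega
          obtain ⟨d', hd'⟩ := Nat.exists_eq_add_of_le this
          rw [hd', Nat.add_sub_cancel_left]
          ring

end Multiplicity

/-! ### Interpolation with multiplicity in bounded total degree (DKSS Proposition 3.1) -/

section Interpolation

variable {n : ℕ}

/-- Interpolation with multiplicity in an arbitrary finite-dimensional space `V` of polynomials:
if `C(m + n − 1, n) · |S| < dim V` (`m ≥ 1`), some nonzero `g ∈ V` has a zero of multiplicity `m`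
at every point of `S` ("the condition that `mult(P, a) ≥ m` imposes `C(m + n − 1, n)` homogeneous
linear constraints on the coefficients of `P`", p. 2310). [cite: DvirEtAl2013,
Proposition 3.1 (proof, §3, p. 2314)] -/
theorem exists_mem_vanishesToOrder {m : ℕ} (hm : 0 < m) (S : Finset (Fin n → K))
    (V : Submodule K (MvPolynomial (Fin n) K)) [Module.Finite K V]
    (hS : (m + n - 1).choose n * S.card < Module.finrank K V) :
    ∃ g ∈ V, g ≠ 0 ∧ ∀ a ∈ S, VanishesToOrder g a m := by
  classical
  set B : Finset (Option (Fin n) →₀ ℕ) :=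
    (univ : Finset (Option (Fin n))).finsuppAntidiag (m - 1) with hB
  let Φ : V →ₗ[K] (↥S × ↥B → K) :=
    LinearMap.pi fun p : ↥S × ↥B =>
      (lcoeff K p.2.1.some).comp
        ((aeval (R := K) fun i => X i + C (p.1.1 i)).toLinearMap.comp V.subtype)
  have hBcard : B.card = (m + n - 1).choose n := by
    rw [hB, card_finsuppAntidiag_nat_eq_choose, card_univ, Fintype.card_option, Fintype.card_fin,
      show n + 1 + (m - 1) - 1 = (m - 1) + n by omega, Nat.choose_symm_add,
      show m - 1 + n = m + n - 1 by omega]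
  have hdimW : Module.finrank K (↥S × ↥B → K) = (m + n - 1).choose n * S.card := by
    rw [Module.finrank_fintype_fun_eq_card, Fintype.card_prod, Fintype.card_coe, Fintype.card_coe,
      hBcard, mul_comm]
  have hlt : Module.finrank K (↥S × ↥B → K) < Module.finrank K V := by
    rw [hdimW]
    exact hS
  obtain ⟨g, hgker, hg0⟩ :=
    (Submodule.ne_bot_iff _).1 (LinearMap.ker_ne_bot_of_finrank_lt (f := Φ) hlt)
  refine ⟨g.1, g.2, fun h => hg0 (Subtype.ext h), fun a ha s hs => ?_⟩
  by_contra hlt'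
  have hsd : s.degree ≤ m - 1 := by omega
  let f : Option (Fin n) →₀ ℕ :=
    Finsupp.equivFunOnFinite.symm fun o => o.elim (m - 1 - s.degree) s
  have hfs : f.some = s := by
    ext i
    simp [f, Finsupp.some_apply]
  have hfB : f ∈ B := by
    rw [hB, mem_finsuppAntidiag]
    refine ⟨?_, Finset.subset_univ _⟩
    rw [Fintype.sum_option]
    simp only [f, Finsupp.coe_equivFunOnFinite_symm, Option.elim]
    rw [← Finsupp.degree_eq_sum]
    omega
  have hΦ : Φ g = 0 := LinearMap.mem_ker.1 hgker
  have hc := congr_fun hΦ (⟨a, ha⟩, ⟨f, hfB⟩)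
  simp only [Φ, LinearMap.pi_apply, LinearMap.comp_apply, Submodule.subtype_apply,
    AlgHom.toLinearMap_apply, lcoeff_apply, Pi.zero_apply, hfs] at hc
  exact (mem_support_iff.1 hs) hc

/-- **DKSS Proposition 3.1:** if `C(m + n − 1, n) · |K| < C(d + n, n)` (`m ≥ 1`) then some nonzero
polynomial of total degree at most `d` has a zero of multiplicity `m` at every point of `K` ("the
number of possible monomials in `P` is `C(d + n, n)` […] there is a nontrivial solution").
[cite: DvirEtAl2013, Proposition 3.1 (§3, p. 2314)] -/
theorem exists_vanishesToOrder_totalDegree_le {m : ℕ} (hm : 0 < m) (d : ℕ)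
    (S : Finset (Fin n → K)) (hS : (m + n - 1).choose n * S.card < (d + n).choose n) :
    ∃ g : MvPolynomial (Fin n) K, g ≠ 0 ∧ g.totalDegree ≤ d ∧
      ∀ a ∈ S, VanishesToOrder g a m := by
  obtain ⟨g, hgV, hg0, hmult⟩ := exists_mem_vanishesToOrder hm S
    (restrictTotalDegree (Fin n) K d) (hS.trans_le (choose_le_finrank_restrictTotalDegree n d))
  exact ⟨g, hg0, (mem_restrictTotalDegree _ _ _).1 hgV, hmult⟩

end Interpolation

/-! ### The Kakeya bound `|K| ≥ (q / (2 − 1/q))ⁿ` (DKSS Theorem 3.2) -/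

section KakeyaDKSS

variable {n : ℕ}

/-- The arithmetic of the parameters `ℓ = kq`, `m = 2ℓ − ℓ/q = (2q − 1)k`, `d = ℓq − 1` in the
proof of DKSS Theorem 3.2 (p. 2314): for `w < ℓ`, `(m − w) q > d − w`. [folklore] -/
theorem dkss_param_ineq {k q w : ℕ} (hk : 1 ≤ k) (hq : 1 ≤ q) (hw : w < k * q) :
    k * q * q - 1 - w < (2 * k * q - k - w) * q := by
  have hkq : 1 ≤ k * q := Nat.mul_pos hk hq
  have h1 : k + w ≤ 2 * k * q := by nlinarith
  have h2 : 1 + w ≤ k * q * q := by nlinarith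
  rw [Nat.sub_sub, Nat.sub_sub]
  zify [h1, h2]
  have hw' : (w : ℤ) ≤ k * q := by exact_mod_cast hw.le
  have hq' : (1 : ℤ) ≤ q := by exact_mod_cast hq
  nlinarith [mul_nonneg (sub_nonneg.2 hw') (sub_nonneg.2 hq')]

/-- A homogeneous polynomial of degree `d` has vanishing Hasse derivatives of weight `> d`.
[folklore] -/
theorem hasseDeriv_homogeneousComponent_eq_zero {i : Fin n →₀ ℕ} {d : ℕ}
    (f : MvPolynomial (Fin n) K) (h : d < i.degree) :
    hasseDeriv K i (homogeneousComponent d f) = 0 := by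
  ext a
  rw [coeff_hasseDeriv, coeff_homogeneousComponent, coeff_zero, if_neg, mul_zero]
  rw [map_add]
  omega

/-- **DKSS Claim 3.3 (the propagation step):** let `P ≠ 0` have total degree `d* ≤ ℓq − 1` and a
zero of multiplicity `m = (2q − 1)k` (`ℓ = kq`) at every point of a Kakeya set; then the top
homogeneous part `H_P` has a zero of multiplicity `ℓ` at EVERY point `b ∈ 𝔽_qⁿ`.  Proof as printed:
for `|i| = w < ℓ`, `Q = P^{(i)}` has multiplicity `m − w` along a line of `K` in direction `b`
(Lemma 2.4, Corollary 2.6), `(m − w)q > d* − w ≥ deg Q_{a,b}`, so `Q_{a,b} ≡ 0` and its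
`t^{d*−w}`-coefficient `(H_P)^{(i)}(b)` vanishes. [cite: DvirEtAl2013,
Claim 3.3 (proof of Theorem 3.2, §3, p. 2315)] -/
theorem vanishesToOrder_homogeneousComponent_of_kakeya [Fintype K] {S : Finset (Fin n → K)}
    (hK : IsKakeya (↑S : Set (Fin n → K))) {k : ℕ} (hk : 1 ≤ k) {P : MvPolynomial (Fin n) K}
    (hPdeg : P.totalDegree ≤ k * Fintype.card K * Fintype.card K - 1)
    (hmult : ∀ a ∈ S, VanishesToOrder P a (2 * k * Fintype.card K - k)) (b : Fin n → K) :
    VanishesToOrder (homogeneousComponent P.totalDegree P) b (k * Fintype.card K) := by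
  classical
  set q := Fintype.card K with hq
  have hq1 : 1 ≤ q := Fintype.card_pos
  set ds := P.totalDegree with hds
  rw [vanishesToOrder_iff_hasseDeriv]
  intro i hi
  set w := i.degree with hw
  by_cases hwd : ds < w
  · rw [hasseDeriv_homogeneousComponent_eq_zero P hwd, map_zero]
  push Not at hwd
  -- the line of `K` in direction `b`
  obtain ⟨a, ha⟩ := hK b
  set Q := hasseDeriv K i P with hQ
  have hQdeg : Q.totalDegree ≤ ds - w := totalDegree_hasseDeriv_le i P
  have hineq := dkss_param_ineq hk hq1 hi
  have hQlt : Q.totalDegree < (2 * k * q - k - w) * q := by omega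
  have hvan : aeval (fun j => Polynomial.C (a j) + Polynomial.C (b j) * Polynomial.X) Q = 0 :=
    aeval_line_eq_zero_of_vanishesToOrder a b Q hQlt fun t₀ =>
      (hmult _ (Finset.mem_coe.1 (ha t₀))).hasseDeriv i
  have hc := coeff_aeval_line a b Q hQdeg
  rw [hvan, Polynomial.coeff_zero, hQ, homogeneousComponent_hasseDeriv, ← hw,
    show ds - w + w = ds by omega] at hc
  exact hc.symm

/-- **DKSS Theorem 3.2 at finite level `ℓ = kq`:** for every Kakeya set `K ⊆ 𝔽_qⁿ` and every
`k ≥ 1`, `C(kq² − 1 + n, n) ≤ C((2q − 1)k + n − 1, n) · |K|` — i.e.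
`|K| ≥ C(d + n, n) / C(m + n − 1, n)` with `d = ℓq − 1`, `m = 2ℓ − ℓ/q`, `ℓ = kq` (the printed proof
before taking `ℓ → ∞`). [cite: DvirEtAl2013, Theorem 3.2 (proof,
§3, pp. 2314–2315)] -/
theorem choose_le_choose_mul_card_of_isKakeya [Fintype K] {S : Finset (Fin n → K)}
    (hK : IsKakeya (↑S : Set (Fin n → K))) {k : ℕ} (hk : 1 ≤ k) :
    (k * Fintype.card K * Fintype.card K - 1 + n).choose n ≤
      ((2 * Fintype.card K - 1) * k + n - 1).choose n * S.card := by
  classical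
  set q := Fintype.card K with hq
  have hq1 : 1 ≤ q := Fintype.card_pos
  by_contra! hlt
  have hm : 0 < (2 * q - 1) * k := Nat.mul_pos (by omega) hk
  obtain ⟨P, hP0, hPdeg, hmult⟩ :=
    exists_vanishesToOrder_totalDegree_le hm (k * q * q - 1) S hlt
  have hm' : (2 * q - 1) * k = 2 * k * q - k := by
    have hkq : k ≤ 2 * k * q := by nlinarith
    zify [show 1 ≤ 2 * q by omega, hkq]
    ring
  rw [hm'] at hmult
  set ds := P.totalDegree with hds
  set H := homogeneousComponent ds P with hH
  have hH0 : H ≠ 0 := homogeneousComponent_totalDegree_ne_zero hP0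
  have hHdeg : H.totalDegree ≤ ds := (homogeneousComponent_isHomogeneous ds P).totalDegree_le
  -- `H` vanishes to order `ℓ = kq` everywhere
  have hHmult : ∀ b : Fin n → K, k * q ≤ mult H b := fun b =>
    (le_mult_iff hH0).2 (vanishesToOrder_homogeneousComponent_of_kakeya hK hk hPdeg hmult b)
  -- the multiplicity Schwartz–Zippel lemma gives the contradiction `ℓ q ≤ d* ≤ ℓq − 1`
  have hSZ := card_mul_sum_mult_le H hH0
  have hsum : q ^ n * (k * q) ≤ ∑ b : Fin n → K, mult H b := by
    have := Finset.sum_le_sum fun b (_ : b ∈ (univ : Finset (Fin n → K))) => hHmult b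
    rwa [Finset.sum_const, Finset.card_univ, Fintype.card_fun, Fintype.card_fin, smul_eq_mul]
      at this
  have h1 : q * (q ^ n * (k * q)) ≤ ds * q ^ n :=
    (Nat.mul_le_mul_left _ hsum).trans (hSZ.trans (Nat.mul_le_mul_right _ hHdeg))
  have h2 : ds * q ^ n ≤ (k * q * q - 1) * q ^ n := Nat.mul_le_mul_right _ hPdeg
  have hqn : 0 < q ^ n := by positivity
  have h3 : q * (k * q) ≤ k * q * q - 1 := by
    have := h1.trans h2
    rw [show q * (q ^ n * (k * q)) = (q * (k * q)) * q ^ n by ring] at this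
    exact Nat.le_of_mul_le_mul_right this hqn
  have h4 : 1 ≤ k * q * q := Nat.mul_pos (Nat.mul_pos hk hq1) hq1
  have : q * (k * q) = k * q * q := by ring
  omega

end KakeyaDKSS

/-! ### Letting `ℓ → ∞`: `|K| ≥ (q / (2 − 1/q))ⁿ ≥ (q/2)ⁿ` -/

section Limit

open Filter Topology

variable {n : ℕ}

/-- `n! · C(N + n − 1, n) = N (N + 1) ⋯ (N + n − 1)`, over `ℝ`. [folklore] -/
theorem factorial_mul_choose_eq_prod (N n : ℕ) :
    ((n.factorial : ℝ) * ((N + n - 1).choose n : ℝ)) = ∏ j ∈ Finset.range n, ((N : ℝ) + j) := by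
  have h1 := Nat.ascFactorial_eq_factorial_mul_choose' N n
  have h2 := Nat.ascFactorial_eq_prod_range N n
  rw [h1] at h2
  have h3 := congrArg (fun x : ℕ => (x : ℝ)) h2
  simpa using h3

/-- The ratio of binomial coefficients of DKSS Theorem 3.2 as a product:
`C(N + n − 1, n) / C(M + n − 1, n) = ∏_{j<n} (N + j)/(M + j)`. [folklore] -/
theorem choose_div_choose_eq_prod (N M n : ℕ) :
    ((N + n - 1).choose n : ℝ) / ((M + n - 1).choose n : ℝ) =
      ∏ j ∈ Finset.range n, (((N : ℝ) + j) / ((M : ℝ) + j)) := by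
  have hfac : (n.factorial : ℝ) ≠ 0 := by positivity
  rw [Finset.prod_div_distrib, ← factorial_mul_choose_eq_prod, ← factorial_mul_choose_eq_prod,
    mul_div_mul_left _ _ hfac]

/-- The limit in DKSS Theorem 3.2: `C(kq² − 1 + n, n) / C((2q − 1)k + n − 1, n) → (q²/(2q − 1))ⁿ`
as `k → ∞` ("`|K| ≥ lim_{ℓ → ∞} ∏ᵢ (q − 1/ℓ + i/ℓ)/(2 − 1/q − 1/ℓ + i/ℓ) = (q/(2 − 1/q))ⁿ`").
[cite: DvirEtAl2013, Theorem 3.2 (proof, §3, p. 2315)] -/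
theorem tendsto_choose_div_choose {q : ℕ} (hq : 1 ≤ q) (n : ℕ) :
    Tendsto (fun k : ℕ => ((k * q * q - 1 + n).choose n : ℝ) /
      (((2 * q - 1) * k + n - 1).choose n : ℝ)) atTop (𝓝 ((((q : ℝ) * q) / (2 * q - 1)) ^ n)) := by
  have hq' : (0 : ℝ) < 2 * (q : ℝ) - 1 := by
    have : (1 : ℝ) ≤ q := by exact_mod_cast hq
    linarith
  -- the ratio is a product for `k ≥ 1`
  have hprod : ∀ k : ℕ, 1 ≤ k → ((k * q * q - 1 + n).choose n : ℝ) /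
      (((2 * q - 1) * k + n - 1).choose n : ℝ) =
      ∏ j ∈ Finset.range n, ((((q : ℝ) * q + j / k)) / ((2 * (q : ℝ) - 1) + j / k)) := by
    intro k hk
    have hN : 1 ≤ k * q * q := Nat.mul_pos (Nat.mul_pos hk hq) hq
    rw [show k * q * q - 1 + n = k * q * q + n - 1 by omega, choose_div_choose_eq_prod]
    refine Finset.prod_congr rfl fun j _ => ?_
    have hk' : (k : ℝ) ≠ 0 := by exact_mod_cast (show k ≠ 0 by omega)
    have h2q : ((2 * q - 1 : ℕ) : ℝ) = 2 * (q : ℝ) - 1 := by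
      rw [Nat.cast_sub (by omega)]
      push_cast
      ring
    push_cast
    rw [h2q]
    field_simp
  -- each factor tends to `q² / (2q − 1)`
  have hfac : ∀ j : ℕ, Tendsto (fun k : ℕ => (((q : ℝ) * q + j / k)) / ((2 * (q : ℝ) - 1) + j / k))
      atTop (𝓝 (((q : ℝ) * q) / (2 * q - 1))) := by
    intro j
    have h0 : Tendsto (fun k : ℕ => (j : ℝ) / k) atTop (𝓝 0) :=
      tendsto_const_div_atTop_nhds_zero_nat _
    have hnum : Tendsto (fun k : ℕ => (q : ℝ) * q + j / k) atTop (𝓝 ((q : ℝ) * q)) := by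
      simpa using tendsto_const_nhds.add h0
    have hden : Tendsto (fun k : ℕ => (2 * (q : ℝ) - 1) + j / k) atTop (𝓝 (2 * (q : ℝ) - 1)) := by
      simpa using tendsto_const_nhds.add h0
    exact hnum.div hden hq'.ne'
  have hlim : Tendsto (fun k : ℕ => ∏ j ∈ Finset.range n,
      ((((q : ℝ) * q + j / k)) / ((2 * (q : ℝ) - 1) + j / k))) atTop
      (𝓝 ((((q : ℝ) * q) / (2 * q - 1)) ^ n)) := by
    have := tendsto_finsetProd (Finset.range n) fun j (_ : j ∈ Finset.range n) => hfac j
    simpa [Finset.prod_const, Finset.card_range, div_pow] using this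
  refine hlim.congr' ?_
  filter_upwards [eventually_ge_atTop 1] with k hk
  exact (hprod k hk).symm

/-- **DKSS Theorem 3.2: every Kakeya set `K ⊆ 𝔽_qⁿ` has `|K| ≥ (q / (2 − 1/q))ⁿ`.**  From the
finite-level bound `|K| ≥ C(ℓq − 1 + n, n) / C(2ℓ − ℓ/q + n − 1, n)` for every `ℓ = kq`, letting
`k → ∞`. [cite: DvirEtAl2013, Theorem 3.2 (§3, p. 2314)] -/
theorem div_pow_le_card_of_isKakeya [Fintype K] {S : Finset (Fin n → K)}
    (hK : IsKakeya (↑S : Set (Fin n → K))) :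
    ((Fintype.card K : ℝ) / (2 - 1 / Fintype.card K)) ^ n ≤ S.card := by
  set q := Fintype.card K with hq
  have hq1 : 1 ≤ q := Fintype.card_pos
  have hqR : (0 : ℝ) < q := by exact_mod_cast hq1
  have heq : (q : ℝ) / (2 - 1 / q) = (q : ℝ) * q / (2 * q - 1) := by
    field_simp
  rw [heq]
  refine le_of_tendsto (tendsto_choose_div_choose hq1 n) ?_
  filter_upwards [eventually_ge_atTop 1] with k hk
  have h := choose_le_choose_mul_card_of_isKakeya hK hk
  have hpos : (0 : ℝ) < (((2 * q - 1) * k + n - 1).choose n : ℝ) := by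
    have hM : 1 ≤ (2 * q - 1) * k := Nat.mul_pos (by omega) hk
    exact_mod_cast Nat.choose_pos (by omega)
  rw [div_le_iff₀ hpos]
  calc ((k * q * q - 1 + n).choose n : ℝ)
      ≤ ((((2 * q - 1) * k + n - 1).choose n * S.card : ℕ) : ℝ) := by
        exact_mod_cast h
    _ = (S.card : ℝ) * (((2 * q - 1) * k + n - 1).choose n : ℝ) := by
        push_cast
        ring

/-- **DKSS Theorem 1.1: every Kakeya set `K ⊆ 𝔽_qⁿ` has `|K| ≥ qⁿ / 2ⁿ`** (from Theorem 3.2,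
as `2 − 1/q ≤ 2`). [cite: DvirEtAl2013, Theorem 1.1 (§1.1, p. 2307)] -/
theorem half_pow_le_card_of_isKakeya [Fintype K] {S : Finset (Fin n → K)}
    (hK : IsKakeya (↑S : Set (Fin n → K))) :
    ((Fintype.card K : ℝ) / 2) ^ n ≤ S.card := by
  refine le_trans ?_ (div_pow_le_card_of_isKakeya hK)
  have hqR : (0 : ℝ) < Fintype.card K := by exact_mod_cast Fintype.card_pos
  gcongr
  · have : (1 : ℝ) / Fintype.card K ≤ 1 := by
      rw [div_le_one hqR]
      exact_mod_cast (Fintype.card_pos : 1 ≤ Fintype.card K)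
    linarith
  · have : (0 : ℝ) < 1 / Fintype.card K := by positivity
    linarith

/-- DKSS Theorem 1.1 in integers: `qⁿ ≤ 2ⁿ · |K|` for every Kakeya set `K ⊆ 𝔽_qⁿ`.
[cite: DvirEtAl2013, Theorem 1.1 (§1.1, p. 2307)] -/
theorem pow_le_two_pow_mul_card_of_isKakeya [Fintype K] {S : Finset (Fin n → K)}
    (hK : IsKakeya (↑S : Set (Fin n → K))) :
    Fintype.card K ^ n ≤ 2 ^ n * S.card := by
  have h := half_pow_le_card_of_isKakeya hK
  rw [div_pow, div_le_iff₀ (by positivity)] at h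
  have h' : ((Fintype.card K ^ n : ℕ) : ℝ) ≤ ((2 ^ n * S.card : ℕ) : ℝ) := by
    push_cast
    linarith
  exact_mod_cast h'

/-- DKSS Theorem 1.1 for a `Set`: `qⁿ ≤ 2ⁿ · |K|`. [cite: DvirEtAl2013,
Theorem 1.1 (§1.1, p. 2307)] -/
theorem pow_le_two_pow_mul_ncard_of_isKakeya [Fintype K] {S : Set (Fin n → K)} (hK : IsKakeya S) :
    Fintype.card K ^ n ≤ 2 ^ n * S.ncard := by
  classical
  rw [Set.ncard_eq_toFinset_card' S]
  exact pow_le_two_pow_mul_card_of_isKakeya (by rwa [Set.coe_toFinset])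

end Limit

end FiniteFieldKakeya

end Literature.Combinatorics.Kakeya
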